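import Summits.NavierStokesRegularity.NavierStokesRegularity.Theses.HodographBetchov
import Literature.Analysis.FluidPDE.TaoLocalisationHolds
import Literature.Analysis.FluidPDE.NSVorticityBKMContinuation
import Literature.Analysis.FluidPDE.TaoEnstrophyLocalisation

/-!
# `SlowClassProduction` (stmt-NavierStokesRegularity-15831), line `birth` — stub 1 `stub_slabProduction`

Route `HodographBetchov`, crux 2.  Registered skeleton
`Cruxes/SlowClassProduction/Lines/birth.lean` (parabolic trichotomy of the slow class), stub 1:
**the enstrophy production `P = ⟪ω, ∇u ω⟫` (`ω = curl u`) of a classical Navier–Stokes solution on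
`ℝ³ × [0,T)` that is Leray–Hopf from a rapidly decaying datum is integrable on every sub-slab
`(0,t₁) × ℝ³`, `t₁ < T`.**  It feeds the INITIAL piece `S_t ∩ {s < τ} ⊆ (0,τ) × ℝ³` of the
composition `SlowClassProduction_of_stubs`.

Proof (known local theory, all inputs are theorems of the tree).  Restrict the solution to the
closed slab `[0,t₁]` (`IsClassicalNSSolutionOn.mono`); its energy is bounded there by the Leray–Hopf
energy inequality (`IsLerayHopfOn.lintegral_enorm_sq_le`), so Tao's regularity persistence
(`tao2011_hasBoundedSobolevNormsOn_holds`: Tao 2013, Cor. 11.1 + Cor. 4.3 + Thm. 5.4 (iv)) puts `u`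
in `L^∞_t H^k_x([0,t₁] × ℝ³)` for every `k`; the Sobolev imbedding on the velocity gradient
(`exists_forall_norm_fderiv_le_of_hasBoundedSobolevNormsOn`) gives `‖∇u‖ ≤ B` on the slab, whence
`|P| ≤ |ω|² ‖∇u‖ ≤ κ² B ‖∇u‖²` (`κ = ‖curlCLM‖`), and `∫₀^{t₁} ∫ ‖∇u‖² ≤ C₁ t₁` by the `k = 1`
Sobolev bound; `P` is jointly continuous on `[0,t₁] × ℝ³` (`IsSmoothSpaceTimeOn.fderiv_slice`),
so it is integrable on `(0,t₁) × ℝ³` by domination (Tonelli for the majorant).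
-/

noncomputable section

-- the summit and its single problem share the name `NavierStokesRegularity` (D-0017 nested layout)
set_option linter.dupNamespace false

namespace Summit.NavierStokesRegularity.NavierStokesRegularity.Theorems.SlowClassProduction.Birth

open Set MeasureTheory Function Literature.Analysis.FluidPDE
open scoped ENNReal NNReal ContDiff RealInnerProductSpace

/-- **Stub `stub_slabProduction` of line `birth` for the crux `SlowClassProduction`
(stmt-NavierStokesRegularity-15831): production is integrable on every sub-slab.**  For `ν, T > 0`,
a classical solution `(u, p)` of the unforced Navier–Stokes system on `ℝ³ × [0,T)` which is
Leray–Hopf on `[0,T)` from its rapidly decaying datum `u 0`, and `0 < t₁ < T`, the enstrophy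
production `z ↦ ⟪curl (u z.1) z.2, fderiv ℝ (u z.1) z.2 (curl (u z.1) z.2)⟫` is integrable on
`(0,t₁) × ℝ³`.  Proof: on the closed slab `[0,t₁]` the solution has finite energy (Leray–Hopf energy
inequality), hence bounded Sobolev norms of all orders (Tao 2013, Cor. 11.1 + Cor. 4.3 +
Thm. 5.4 (iv), tree theorem `tao2011_hasBoundedSobolevNormsOn_holds`); the Sobolev imbedding bounds
`‖∇u‖ ≤ B` on the slab, so `|P| ≤ ‖curlCLM‖² B ‖∇u‖²`, and `∫⁻ ‖∇u(t)‖² ≤ C₁` uniformly in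
`t ∈ [0,t₁]`; domination by the jointly continuous majorant closes.
[cite: Tao2011, Cor. 11.1 + Cor. 4.3 + Thm. 5.4 (iv)] -/
theorem stub_slabProduction :
    ∀ (ν T : ℝ), 0 < ν → 0 < T →
      ∀ (u : ℝ → EuclideanSpace ℝ (Fin 3) → EuclideanSpace ℝ (Fin 3))
        (p : ℝ → EuclideanSpace ℝ (Fin 3) → ℝ),
        Literature.Analysis.FluidPDE.IsClassicalNSSolutionOn (Set.Ico 0 T) ν 0 u p →
        Literature.Analysis.FluidPDE.IsLerayHopfOn T ν 0 (u 0) u →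
        Literature.Analysis.FluidPDE.HasRapidSpatialDecay (u 0) →
        ∀ t₁ : ℝ, 0 < t₁ → t₁ < T →
          MeasureTheory.IntegrableOn
            (fun z : ℝ × EuclideanSpace ℝ (Fin 3) =>
              inner ℝ (Literature.Analysis.FluidPDE.curl (u z.1) z.2)
                (fderiv ℝ (u z.1) z.2 (Literature.Analysis.FluidPDE.curl (u z.1) z.2)))
            (Set.Ioo 0 t₁ ×ˢ (Set.univ : Set (EuclideanSpace ℝ (Fin 3)))) := by
  intro ν T hν _hT u p hcl hLH hdec t₁ ht₁ ht₁T
  -- ### the closed slab `[0,t₁]`: finite energy, bounded Sobolev norms, bounded gradient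
  have hUD : UniqueDiffOn ℝ (Icc 0 t₁) := uniqueDiffOn_Icc ht₁
  have hsol : IsClassicalNSSolutionOn (Icc 0 t₁) ν 0 u p :=
    hcl.mono (Icc_subset_Ico_right ht₁T) hUD
  have hE : ∃ C : ℝ≥0, ∀ t ∈ Icc 0 t₁, ∫⁻ x, ‖u t x‖ₑ ^ 2 ≤ C :=
    ⟨(2 * VectorCalculus.kineticEnergy (u 0)).toNNReal, fun t ht =>
      hLH.lintegral_enorm_sq_le hν.le ⟨ht.1, ht.2.trans ht₁T.le⟩⟩
  have hH : HasBoundedSobolevNormsOn (Icc 0 t₁) u :=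
    tao2011_hasBoundedSobolevNormsOn_holds hν ht₁ hsol hE hdec
  have hC3 : ∀ t ∈ Icc 0 t₁, ContDiff ℝ 3 (u t) := fun t ht =>
    (hsol.contDiff_velocity ht).of_le (by norm_cast)
  obtain ⟨B, hB0, hB⟩ := exists_forall_norm_fderiv_le_of_hasBoundedSobolevNormsOn hC3 hH
  obtain ⟨C₁, hC₁⟩ := hH 1
  -- ### notation
  set D : ℝ × EuclideanSpace ℝ (Fin 3) → EuclideanSpace ℝ (Fin 3) →L[ℝ] EuclideanSpace ℝ (Fin 3) :=
    fun z => fderiv ℝ (u z.1) z.2 with hD_def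
  set κ : ℝ := ‖curlCLM‖ with hκ_def
  set P : ℝ × EuclideanSpace ℝ (Fin 3) → ℝ :=
    fun z => inner ℝ (curl (u z.1) z.2) (fderiv ℝ (u z.1) z.2 (curl (u z.1) z.2)) with hP_def
  set g : ℝ × EuclideanSpace ℝ (Fin 3) → ℝ := fun z => κ ^ 2 * B * ‖D z‖ ^ 2 with hg_def
  change IntegrableOn P (Ioo 0 t₁ ×ˢ univ)
  -- ### pointwise domination `|P| ≤ κ² B ‖∇u‖²` on the slab
  have hP_le : ∀ z : ℝ × EuclideanSpace ℝ (Fin 3), z.1 ∈ Icc 0 t₁ → ‖P z‖ ≤ g z := by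
    intro z hz
    have hω : ‖curl (u z.1) z.2‖ ≤ κ * ‖D z‖ := norm_curl_le _ _
    have hκ0 : 0 ≤ κ := by rw [hκ_def]; exact norm_nonneg curlCLM
    have hω0 : 0 ≤ ‖curl (u z.1) z.2‖ := norm_nonneg _
    have hDz : ‖D z‖ ≤ B := hB z.1 hz z.2
    calc ‖P z‖ ≤ ‖curl (u z.1) z.2‖ * ‖D z (curl (u z.1) z.2)‖ := norm_inner_le_norm _ _
      _ ≤ ‖curl (u z.1) z.2‖ * (‖D z‖ * ‖curl (u z.1) z.2‖) := by
          gcongr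
          exact (D z).le_opNorm _
      _ = ‖D z‖ * ‖curl (u z.1) z.2‖ ^ 2 := by ring
      _ ≤ B * (κ * ‖D z‖) ^ 2 := by
          gcongr
      _ = g z := by rw [hg_def]; ring
  -- ### joint continuity of `∇u`, of `P` and of the majorant on `[0,t₁] × ℝ³`
  have hDcont : ContinuousOn D (Icc 0 t₁ ×ˢ univ) :=
    (hsol.smooth_velocity.fderiv_slice hUD).continuousOn
  have hωcont : ContinuousOn (fun z : ℝ × EuclideanSpace ℝ (Fin 3) => curl (u z.1) z.2)
      (Icc 0 t₁ ×ˢ univ) :=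
    curlCLM.continuous.comp_continuousOn hDcont
  have hPcont : ContinuousOn P (Icc 0 t₁ ×ˢ univ) :=
    hωcont.inner (hDcont.clm_apply hωcont)
  have hgcont : ContinuousOn g (Icc 0 t₁ ×ˢ univ) :=
    continuousOn_const.mul (hDcont.norm.pow 2)
  have hmeasS : MeasurableSet (Ioo (0 : ℝ) t₁ ×ˢ (univ : Set (EuclideanSpace ℝ (Fin 3)))) :=
    measurableSet_Ioo.prod MeasurableSet.univ
  have hsub : Ioo (0 : ℝ) t₁ ×ˢ (univ : Set (EuclideanSpace ℝ (Fin 3))) ⊆ Icc 0 t₁ ×ˢ univ :=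
    prod_mono Ioo_subset_Icc_self Subset.rfl
  have hPm : AEStronglyMeasurable P (volume.restrict (Ioo (0 : ℝ) t₁ ×ˢ univ)) :=
    (hPcont.mono hsub).aestronglyMeasurable hmeasS
  have hgm : AEStronglyMeasurable g (volume.restrict (Ioo (0 : ℝ) t₁ ×ˢ univ)) :=
    (hgcont.mono hsub).aestronglyMeasurable hmeasS
  -- ### the majorant is integrable on the slab (Tonelli + the `k = 1` Sobolev bound)
  have hslice : ∀ t ∈ Icc 0 t₁,
      ∫⁻ x, ‖g (t, x)‖ₑ ≤ ENNReal.ofReal (κ ^ 2 * B) * C₁ := by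
    intro t ht
    have hc0 : 0 ≤ κ ^ 2 * B := by positivity
    have hgx : ∀ x, ‖g (t, x)‖ₑ = ENNReal.ofReal (κ ^ 2 * B) * ‖iteratedFDeriv ℝ 1 (u t) x‖ₑ ^ 2 := by
      intro x
      have hg0 : 0 ≤ g (t, x) := by rw [hg_def]; positivity
      rw [Real.enorm_eq_ofReal hg0, hg_def]
      change ENNReal.ofReal (κ ^ 2 * B * ‖fderiv ℝ (u t) x‖ ^ 2) = _
      rw [ENNReal.ofReal_mul hc0, ← norm_iteratedFDeriv_one (𝕜 := ℝ) (u t),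
        ENNReal.ofReal_pow (norm_nonneg _), ofReal_norm]
    calc ∫⁻ x, ‖g (t, x)‖ₑ
        = ∫⁻ x, ENNReal.ofReal (κ ^ 2 * B) * ‖iteratedFDeriv ℝ 1 (u t) x‖ₑ ^ 2 :=
          lintegral_congr hgx
      _ = ENNReal.ofReal (κ ^ 2 * B) * ∫⁻ x, ‖iteratedFDeriv ℝ 1 (u t) x‖ₑ ^ 2 := by
          rw [lintegral_const_mul' _ _ ENNReal.ofReal_ne_top]
      _ ≤ ENNReal.ofReal (κ ^ 2 * B) * C₁ := by
          gcongr
          exact hC₁ t ht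
  have hg_fin : ∫⁻ z in Ioo (0 : ℝ) t₁ ×ˢ (univ : Set (EuclideanSpace ℝ (Fin 3))), ‖g z‖ₑ < ⊤ := by
    have hμ : (volume.restrict (Ioo (0 : ℝ) t₁ ×ˢ (univ : Set (EuclideanSpace ℝ (Fin 3)))) :
        Measure (ℝ × EuclideanSpace ℝ (Fin 3))) =
        (volume.restrict (Ioo (0 : ℝ) t₁)).prod
          ((volume : Measure (EuclideanSpace ℝ (Fin 3))).restrict univ) := by
      rw [Measure.prod_restrict, ← Measure.volume_eq_prod]
    rw [hμ]
    calc ∫⁻ z, ‖g z‖ₑ ∂(volume.restrict (Ioo (0 : ℝ) t₁)).prod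
            ((volume : Measure (EuclideanSpace ℝ (Fin 3))).restrict univ)
        ≤ ∫⁻ t in Ioo (0 : ℝ) t₁, ∫⁻ x in univ, ‖g (t, x)‖ₑ := lintegral_prod_le _
      _ ≤ ∫⁻ _ in Ioo (0 : ℝ) t₁, ENNReal.ofReal (κ ^ 2 * B) * C₁ := by
          refine setLIntegral_mono' measurableSet_Ioo fun t ht => ?_
          rw [Measure.restrict_univ]
          exact hslice t (Ioo_subset_Icc_self ht)
      _ = ENNReal.ofReal (κ ^ 2 * B) * C₁ * volume (Ioo (0 : ℝ) t₁) := setLIntegral_const _ _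
      _ < ⊤ := by
          refine ENNReal.mul_lt_top (ENNReal.mul_lt_top ENNReal.ofReal_lt_top ENNReal.coe_lt_top) ?_
          rw [Real.volume_Ioo]
          exact ENNReal.ofReal_lt_top
  have hg_int : Integrable g (volume.restrict (Ioo (0 : ℝ) t₁ ×ˢ (univ : Set (EuclideanSpace ℝ (Fin 3))))) :=
    ⟨hgm, hg_fin⟩
  -- ### domination
  refine Integrable.mono' hg_int hPm ?_
  filter_upwards [ae_restrict_mem hmeasS] with z hz
  exact hP_le z (Ioo_subset_Icc_self hz.1)

end Summit.NavierStokesRegularity.NavierStokesRegularity.Theorems.SlowClassProduction.Birth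

end
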